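import Mathlib
import HarnessLib
import Literature.NumberTheory.Sieve.LinearEquationsInPrimes
import Literature.NumberTheory.Sieve.PretentiousDistance
import Literature.NumberTheory.Sieve.BourgainSarnakZieglerCriterion

/-!
# Sketch — crux ideas for `InverseSieveTuples.TupleElliott` (stmt-Parity-14832), round 1, ideator 1

The verbatim crux is refuted (`InverseSieveTuplesTupleElliott_refuted`, shift-divisor blindness);
both ideas target the repaired t = 1 instance `HLEPairsOffShift` below (refuter's repair C″:
non-pretentiousness measured off the primes dividing the shift), which is the shape the route's
`SieveStep` consumes.  Only signatures are required to elaborate here (no proofs).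
-/

open scoped ArithmeticFunction.vonMangoldt ArithmeticFunction.Moebius ComplexConjugate
open Filter Finset Literature.NumberTheory.Sieve

namespace Summit.Parity.GeneralizedHardyLittlewood.Cruxes.TupleElliott

/-! ## Common target: the repaired crux at t = 1 for the system (n, n + h), |h| ≤ L N -/

/-- Pretentious distance squared summed only over primes NOT dividing `D` (repair C″ of the
refuter: for the system `(n, n+h)` one has `D(Ψ) = h`). -/
noncomputable def distSqOff (D : ℕ) (f g : ℕ → ℂ) (x : ℝ) : ℝ :=
  ∑ p ∈ (Nat.primesLE ⌊x⌋₊).filter (fun p => ¬ p ∣ D), (1 - (f p * conj (g p))).re / (p : ℝ)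

/-- Repaired HLE, t = 1, Ψ = (n, n + h) with 1 ≤ h ≤ L·N: relative cancellation `η N` for every
1-bounded multiplicative `f` whose distance OFF the primes dividing `h` from every twisted
character of conductor `≤ A₀` is `≥ A₀`. -/
def HLEPairsOffShift : Prop :=
  ∀ L : ℕ, ∀ η : ℝ, 0 < η → ∃ A₀ : ℝ, ∃ N₀ : ℕ, ∀ N : ℕ, N₀ ≤ N → ∀ h : ℕ, 1 ≤ h → h ≤ L * N →
    ∀ f : ArithmeticFunction ℂ, f.IsMultiplicative → (∀ n, ‖f n‖ ≤ 1) →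
      (∀ (q : ℕ) (χ : DirichletCharacter ℂ q) (τ : ℝ), 1 ≤ q → (q : ℝ) ≤ A₀ → |τ| ≤ N →
          A₀ ≤ distSqOff h (⇑f) (twistedChar χ τ) N) →
      ‖∑ n ∈ Icc 1 N, ((Λ n : ℝ) : ℂ) * f (n + h)‖ ≤ η * N

namespace FreeLargePrimePhases

/-! ## Idea 1 — free large-prime phases → ℓ¹ over the rough cofactor → slope-averaged HL -/

/-- `Q` is `y`-rough: every prime factor of `Q` is `≥ y` (so `Q = 1` is rough). -/
def IsRough (y Q : ℕ) : Prop := ∀ p ∈ Q.primeFactors, y ≤ p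

instance (y Q : ℕ) : Decidable (IsRough y Q) := by unfold IsRough; infer_instance

/-- FIRST LEMMA (elementary, provable now).  Write `n + h = s · Q` with `s` the `y`-smooth part
and `Q` the `y`-rough part; multiplicativity gives `f(n+h) = f(s) f(Q)` with `|f(Q)| ≤ 1`, and the
triangle inequality over `Q` makes the values of `f` on primes `≥ y` disappear:
`|∑_{n ≤ N} Λ(n) f(n+h)| ≤ ∑_{Q y-rough} |∑_{s y-smooth} f(s) Λ(sQ − h)|`. -/
def FreePhaseDomination : Prop :=
  ∀ (y N h : ℕ), ∀ f : ArithmeticFunction ℂ, f.IsMultiplicative → (∀ n, ‖f n‖ ≤ 1) →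
    ‖∑ n ∈ Icc 1 N, ((Λ n : ℝ) : ℂ) * f (n + h)‖ ≤
      ∑ Q ∈ (Icc 1 (N + h)).filter (fun Q => IsRough y Q),
        ‖∑ s ∈ (Nat.smoothNumbersUpTo (N + h) y).filter (fun s => h < s * Q ∧ s * Q ≤ N + h),
            ((Λ (s * Q - h) : ℝ) : ℂ) * f s‖

/-- The two-form system `(s·n − h, s'·n − h)` in the variable `n` (slopes `s, s'`). -/
def slopePair (s s' h : ℕ) : Fin 2 → AffLinForm 1 :=
  ![⟨![(s : ℤ)], -(h : ℤ)⟩, ⟨![(s' : ℤ)], -(h : ℤ)⟩]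

/-- THE CRUX-WITHIN (f-free, prime pairs only): Hardy–Littlewood for the pair systems
`(Qs − h, Qs' − h)`, `Q ∼ N/S`, with a log-power saving in ℓ¹-MEAN over the slope pairs
`s ≠ s' ∈ [S, 2S]`, for every fixed power window `N^θ ≤ S ≤ N^{1/4}` (plain form; the line needs
the same uniformly in progressions `d ∣ Q`, `d ≤ N^{O(θ)}`, a standard uniformity). -/
def SlopeHL : Prop :=
  ∀ θ : ℝ, 0 < θ → θ ≤ 1 / 4 → ∀ A : ℝ, ∃ C : ℝ, ∀ N : ℕ, 2 ≤ N → ∀ h : ℕ, 1 ≤ h → h ≤ N →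
    ∀ S : ℕ, (N : ℝ) ^ θ ≤ S → (S : ℝ) ≤ (N : ℝ) ^ (1 / 4 : ℝ) →
      (∑ s ∈ Icc S (2 * S), ∑ s' ∈ (Icc S (2 * S)).filter (fun s' => s' ≠ s),
          |(∑ Q ∈ Icc (N / S) (2 * (N / S)), Λ (Q * s - h) * Λ (Q * s' - h)) -
              singularProduct (slopePair s s' h) * (((N / S : ℕ) : ℝ))|) ≤
        C * S * N / Real.log N ^ A

/-- Shape of the intended composition (idea stage, not a skeleton): the f-free averaged HL
statement, the pretentious kernel lemma and the smooth-part tail lemma give the repaired crux at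
t = 1.  Stated here only to fix the direction `SlopeHL → … → HLEPairsOffShift`. -/
def Reduction : Prop := SlopeHL → FreePhaseDomination → HLEPairsOffShift

end FreeLargePrimePhases

namespace KataiDualDensePieces

/-! ## Idea 2 — Kátai/BSZ duality on the DENSE Heath-Brown pieces makes the randomness half f-free -/

/-- A balanced Heath-Brown Type-II piece read as a function of one variable:
`a_N(m) = ∑_{uv = m, √N/2 < u ≤ 2√N} μ(u) μ(v)` (Möbius on the shifted multiplication table at the
diagonal, before shifting). -/
noncomputable def tablePiece (N m : ℕ) : ℂ :=
  ∑ x ∈ m.divisorsAntidiagonal with (Nat.sqrt N / 2 < x.1 ∧ x.1 ≤ 2 * Nat.sqrt N),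
    ((μ x.1 : ℝ) : ℂ) * ((μ x.2 : ℝ) : ℂ)

/-- FIRST LEMMA (the transfer step; = Bourgain–Sarnak–Ziegler Thm 2 with `(F, ν) := (a, f)`):
small dilation self-correlations of a 1-bounded `a` along `(pm, qm)`, `p ≠ q ≤ e^{1/τ}`, give
orthogonality of `a` to EVERY 1-bounded multiplicative `f` at once — the universal quantifier over
`f` in the crux is discharged by an `f`-free hypothesis. -/
def KataiTransfer : Prop :=
  ∀ τ : ℝ, 0 < τ → τ ≤ 1 / 100 → ∀ a : ℕ → ℂ, (∀ n, ‖a n‖ ≤ 1) →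
    (∀ p q : ℕ, p.Prime → q.Prime → p ≠ q → (p : ℝ) ≤ Real.exp (1 / τ) →
        (q : ℝ) ≤ Real.exp (1 / τ) →
        ∀ᶠ M : ℕ in atTop, ‖∑ m ∈ Icc 1 M, a (p * m) * conj (a (q * m))‖ ≤ τ * M) →
    ∀ f : ArithmeticFunction ℂ, f.IsMultiplicative → (∀ n, ‖f n‖ ≤ 1) →
      ∀ᶠ N : ℕ in atTop, ‖∑ n ∈ Icc 1 N, f n * a n‖ ≤ 2 * Real.sqrt (τ * Real.log (1 / τ)) * N

/-- `KataiTransfer` is literally the tree's named fact with the roles `(F, ν) = (a, f)`. -/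
theorem kataiTransfer_of_bsz (h : bourgainSarnakZiegler_criterion) :
    ∃ τ₀ : ℝ, 0 < τ₀ ∧ ∀ τ : ℝ, 0 < τ → τ ≤ τ₀ → ∀ a : ℕ → ℂ, (∀ n, ‖a n‖ ≤ 1) →
      (∀ p q : ℕ, p.Prime → q.Prime → p ≠ q → (p : ℝ) ≤ Real.exp (1 / τ) →
          (q : ℝ) ≤ Real.exp (1 / τ) →
          ∀ᶠ M : ℕ in atTop, ‖∑ m ∈ Icc 1 M, a (p * m) * conj (a (q * m))‖ ≤ τ * M) →
      ∀ f : ArithmeticFunction ℂ, f.IsMultiplicative → (∀ n, ‖f n‖ ≤ 1) →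
        ∀ᶠ N : ℕ in atTop, ‖∑ n ∈ Icc 1 N, f n * a n‖ ≤
          2 * Real.sqrt (τ * Real.log (1 / τ)) * N := by
  obtain ⟨τ₀, hτ₀, H⟩ := h
  refine ⟨τ₀, hτ₀, fun τ hτ hττ₀ a ha hcorr f hf hf1 => ?_⟩
  have := H τ hτ hττ₀ a f ha hf hf1 hcorr
  simpa [mul_comm] using this

/-- THE CRUX-WITHIN (f-free, prime-free): the dilation self-correlations of the shifted balanced
piece are small with a log-power saving, uniformly for prime dilations up to `exp((log N)^c)`:
`∑_{n ≤ N/q} a_N(pn + h) a_N(qn + h)` — unfolded, Möbius quadruples `μ(u)μ(v)μ(u')μ(v')` on the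
twisted determinant surface `q·uv − p·u'v' = (q − p)·h` with `u, u' ∼ √N`. -/
def BalancedMoebiusCore : Prop :=
  ∀ c : ℝ, 0 < c → c ≤ 1 / 10 → ∃ N₀ : ℕ, ∀ N : ℕ, N₀ ≤ N → ∀ h : ℕ, 1 ≤ h → h ≤ N →
    ∀ p q : ℕ, p.Prime → q.Prime → p ≠ q → (p : ℝ) ≤ Real.exp (Real.log N ^ c) →
      (q : ℝ) ≤ Real.exp (Real.log N ^ c) →
      ‖∑ n ∈ Icc 1 (N / q), tablePiece N (p * n + h) * conj (tablePiece N (q * n + h))‖ ≤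
        ((N / q : ℕ) : ℝ) / Real.log N ^ (4 * c + 4)

end KataiDualDensePieces

end Summit.Parity.GeneralizedHardyLittlewood.Cruxes.TupleElliott
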